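import Summits.NavierStokesRegularity.NavierStokesRegularity.Theorems.AxisymmetricExtremalityAxisymmetricKatoGlobalStubSeregin2020TypeIILemma22EnergyClassAcrossAxisV3
import HarnessLib

/-!
# Seregin 2020, Lemma 2.2: the v3 `EnergyClass` on a slab WITHOUT singular axis points — L22-B, piece F2″

Seat ns-es-p1 g3 (INPUTS A1 / L22-B; cut owner ns-inputs-plan g5).  `energyClass_v3_of_sFreeSlab`: if on the slab `]−R²,0[ × B(0,2R)`
the data are those of `energyClass_ineq_acrossAxis_v3` (sibling `…EnergyClassAcrossAxisV3`: `Φ`, `∇Φ` continuous on the slab — across the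
regular axis —, `C²`/`∂ₜ` data, a continuous divergence-free `C¹` drift `U` OFF the axis, `∬_{slab}|U|³ < ∞`, the pointwise supersolution
inequality off the axis, `Φ ≥ k` at the axis points of the slab), then the CANONICAL v3 `EnergyClass Φ U k R`
(`Cruxes/AxisymmetricKatoGlobal/Seregin2020Lemma22ExpansionOfPositivity.lean` l.68–84, = `Standing` v3's last clause) holds — stated UNFOLDED
(a `Cruxes` def is not importable here).  This is L22-B for a slab that the parabolic-null axis set `S` does not meet; the passage across
`S` inside the slab is the remaining piece F3.

WHAT THIS IS NOT: not `energyClass_acrossAxis_of_classV` in full (the `S`-passage), not Lemma 2.2, not NS regularity.  No summit statement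
is proved here.  [NazarovUraltseva2012 §3 (3.3), (3.9), Remark 9; Seregin2020 §3 pp. 9–10]
-/

-- the problem directory repeats the summit name (D-0017); core's `dupNamespace` linter fires
set_option linter.dupNamespace false

noncomputable section

open MeasureTheory Set Function Filter Topology TopologicalSpace Metric WithLp intervalIntegral
open scoped NNReal ENNReal InnerProductSpace RealInnerProductSpace

namespace Summit.NavierStokesRegularity.NavierStokesRegularity.Theorems.AxisymmetricKatoGlobal.EulerScaling

open Literature.Analysis.FluidPDE Literature.Analysis.FluidPDE.Seregin2020

/-- **The v3 `EnergyClass Φ U k R` (unfolded) on an `S`-free slab `]−R²,0[ × B(0,2R)`** (module docstring).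
[cite: NazarovUraltseva2012, §3 (3.3), (3.9), Remark 9] -/
theorem energyClass_v3_of_sFreeSlab {R k : ℝ}
    {Φ : ℝ → EuclideanSpace ℝ (Fin 3) → ℝ} {U : ℝ → EuclideanSpace ℝ (Fin 3) → EuclideanSpace ℝ (Fin 3)}
    (hΦc : ContinuousOn (uncurry Φ) (Ioo (-R ^ 2) 0 ×ˢ ball (0 : EuclideanSpace ℝ (Fin 3)) (2 * R)))
    (hΦg : ContinuousOn (fun z : ℝ × EuclideanSpace ℝ (Fin 3) => fderiv ℝ (Φ z.1) z.2)
      (Ioo (-R ^ 2) 0 ×ˢ ball (0 : EuclideanSpace ℝ (Fin 3)) (2 * R)))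
    (hΦs : ∀ z ∈ Ioo (-R ^ 2) 0 ×ˢ (ball (0 : EuclideanSpace ℝ (Fin 3)) (2 * R) ∩ {x | cylRadius x ≠ 0}),
      ContDiffAt ℝ 2 (Φ z.1) z.2)
    (hΦt : ∀ z ∈ Ioo (-R ^ 2) 0 ×ˢ (ball (0 : EuclideanSpace ℝ (Fin 3)) (2 * R) ∩ {x | cylRadius x ≠ 0}),
      DifferentiableAt ℝ (fun r => Φ r z.2) z.1)
    (hΦt' : ContinuousOn (fun z : ℝ × EuclideanSpace ℝ (Fin 3) => deriv (fun r => Φ r z.2) z.1)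
      (Ioo (-R ^ 2) 0 ×ˢ (ball (0 : EuclideanSpace ℝ (Fin 3)) (2 * R) ∩ {x | cylRadius x ≠ 0})))
    (hUc : ContinuousOn (uncurry U) (Ioo (-R ^ 2) 0 ×ˢ (ball (0 : EuclideanSpace ℝ (Fin 3)) (2 * R) ∩ {x | cylRadius x ≠ 0})))
    (hUs : ∀ z ∈ Ioo (-R ^ 2) 0 ×ˢ (ball (0 : EuclideanSpace ℝ (Fin 3)) (2 * R) ∩ {x | cylRadius x ≠ 0}),
      ContDiffAt ℝ 1 (U z.1) z.2)
    (hdivU : ∀ z ∈ Ioo (-R ^ 2) 0 ×ˢ (ball (0 : EuclideanSpace ℝ (Fin 3)) (2 * R) ∩ {x | cylRadius x ≠ 0}),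
      VectorCalculus.divergence (U z.1) z.2 = 0)
    (hU3 : (∫⁻ z in Ioo (-R ^ 2) 0 ×ˢ ball (0 : EuclideanSpace ℝ (Fin 3)) (2 * R), ‖U z.1 z.2‖ₑ ^ (3 : ℕ)) < ⊤)
    (hsup : ∀ z ∈ Ioo (-R ^ 2) 0 ×ˢ (ball (0 : EuclideanSpace ℝ (Fin 3)) (2 * R) ∩ {x | cylRadius x ≠ 0}),
      0 ≤ deriv (fun r => Φ r z.2) z.1 + fderiv ℝ (Φ z.1) z.2 (U z.1 z.2) +
        2 / cylRadius z.2 * partialDeriv (eR z.2) (Φ z.1) z.2 - (Laplacian.laplacian (Φ z.1)) z.2)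
    (hk : ∀ z ∈ Ioo (-R ^ 2) 0 ×ˢ ball (0 : EuclideanSpace ℝ (Fin 3)) (2 * R), cylRadius z.2 = 0 → k ≤ Φ z.1 z.2) :
    ∀ (H : ℝ → ℝ), ContDiff ℝ 2 H → (∀ v, deriv H v ≤ 0) → (∀ v, 0 ≤ H v) →
      (∀ v, 0 ≤ deriv (deriv H) v) → (∀ v, deriv H v ^ 2 ≤ 2 * H v * deriv (deriv H) v) →
      (∀ v, k ≤ v → H v = 0) →
    ∀ (Θ : EuclideanSpace ℝ (Fin 3) → ℝ), ContDiff ℝ 1 Θ → HasCompactSupport Θ →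
      tsupport Θ ⊆ ball (0 : EuclideanSpace ℝ (Fin 3)) (2 * R) →
    ∀ (η : ℝ → ℝ), ContDiff ℝ 1 η → (∀ s, 0 ≤ η s) →
    ∀ (t₁ t₂ : ℝ), -R ^ 2 < t₁ → t₁ ≤ t₂ → t₂ < 0 →
      ENNReal.ofReal (η t₂ * ∫ x, H (Φ t₂ x) * Θ x ^ 2) +
        ∫⁻ z in Icc t₁ t₂ ×ˢ (univ : Set (EuclideanSpace ℝ (Fin 3))), ENNReal.ofReal
          (1 / 2 * η z.1 * (deriv (deriv H) (Φ z.1 z.2) * ‖gradient (Φ z.1) z.2‖ ^ 2 * Θ z.2 ^ 2))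
      ≤ ENNReal.ofReal (η t₁ * (∫ x, H (Φ t₁ x) * Θ x ^ 2) +
          (4 * ∫ z in Icc t₁ t₂ ×ˢ (univ : Set (EuclideanSpace ℝ (Fin 3))),
            η z.1 * (H (Φ z.1 z.2) * ‖gradient Θ z.2‖ ^ 2)) +
          (∫ z in Icc t₁ t₂ ×ˢ (univ : Set (EuclideanSpace ℝ (Fin 3))),
            η z.1 * (H (Φ z.1 z.2) * inner ℝ (U z.1 z.2) (gradient (fun y => Θ y ^ 2) z.2))) +
          (∫ z in Icc t₁ t₂ ×ˢ (univ : Set (EuclideanSpace ℝ (Fin 3))),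
            η z.1 * (2 / cylRadius z.2 * (H (Φ z.1 z.2) * fderiv ℝ (fun y => Θ y ^ 2) z.2 (eR z.2)))) +
          (∫ z in Icc t₁ t₂ ×ˢ (univ : Set (EuclideanSpace ℝ (Fin 3))), |deriv η z.1| * (H (Φ z.1 z.2) * Θ z.2 ^ 2))) := by
  intro H hH hH' hH0 hH2 hκ hHk Θ hΘ hΘc hΘO η hη hη0 t₁ t₂ h1 h12 h2
  exact energyClass_ineq_acrossAxis_v3 isOpen_ball hΦc hΦg hΦs hΦt hΦt' hUc hUs hdivU hU3 hsup hk hH hH' hH0 hH2 hκ hHk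
    hΘ hΘc hΘO hη hη0 h1 h12 h2

end Summit.NavierStokesRegularity.NavierStokesRegularity.Theorems.AxisymmetricKatoGlobal.EulerScaling

end
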